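import Literature.ModelTheory.ExponentialFields.Wilkie1996Induction
import Literature.ModelTheory.ExponentialFields.Wilkie1989KhovanskiiProofs
import Literature.ModelTheory.ExponentialFields.Wilkie1989KhovanskiiParams
import Literature.ModelTheory.ExponentialFields.Wilkie1989Lemma3Proofs
import Mathlib.LinearAlgebra.Matrix.ToLinearEquiv
import HarnessLib

/-!
# Wilkie 1996, Proposition 9.2 (iii): finiteness of the non-singular zeros of a system from `Mˢₙ`

Topic `Literature/ModelTheory/ExponentialFields`.  A. J. Wilkie, J. Amer. Math. Soc. 9 (1996),
§9, works with the rings `Mˢₙ = k[xᵢ, (1 + xᵢ²)⁻¹, e(xᵢ) (i ≤ n), exp(xᵢ) (i ∈ s)]`,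
`e(x) = exp((1 + x²)⁻¹)`, of functions `Kⁿ → K` for models `k ⊆ K` of `T_exp`
(M. den Besten, MSc thesis, Utrecht 2016, Definition 6.2.5; in this tree the presentations
`MvPolynomial (RealExpModel.MsVar n) k` with the evaluation `RealExpModel.msEval`, the derivations
`RealExpModel.msD` and the non-singular zeros `RealExpModel.IsMsZero` of `Wilkie1996Induction.lean`).
Proposition 9.2 (iii) (p. 1084; den Besten, Proposition 6.2.7 (iii)) states: *for
`f₁, …, fₙ ∈ Mˢₙ` there are only finitely many `γ̄ ∈ Kⁿ` with `f₁(γ̄) = ⋯ = fₙ(γ̄) = 0` and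
`det (∂(f₁, …, fₙ)/∂(x₁, …, xₙ))(γ̄) ≠ 0`* — Khovanskiĭ's finiteness theorem transferred to the
models of `T_exp`.  It is the finiteness statement through which the non-singular zero `ᾱ` of
the configuration `(*)ₘ` becomes `T_e`-definable over `k` and the `exp αᵢ` (the Claim in the proof
of den Besten's Lemma 7.2.4, `dim_{k'} k* ≤ m`), i.e. the entrance to the valuation-theoretic
half (§§10–11) of the proof of the boundedness leaf `Wilkie1996_expPolynomialPoints_bounded`.

This file **proves** it (`RealExpModel.finite_setOf_isMsZero`), unconditionally, from the tree's
transferred Khovanskiĭ theorem for square systems of exponential *terms*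
(`Wilkie1989_khovanskiiProposition.finite_nonsingularZeroSet` with
`Wilkie1989_khovanskiiProposition_holds`, `Wilkie1989KhovanskiiParams.lean` /
`Wilkie1989KhovanskiiProofs.lean`): the generator `(1 + xᵢ²)⁻¹` is not a term, so a system
`P₁, …, Pₙ` from `Mˢₙ` in the unknowns `x̄` is presented as the square system of `2n` term
functions (`RealExpModel.termFnRing`) in the unknowns `(x̄, ū)`

  `Pᵢ(x̄, ū, exp ū, exp x̄) = 0 (i ≤ n)`,  `uᵢ (1 + xᵢ²) - 1 = 0 (i ≤ n)`,

whose zero `(ᾱ, (1 + ᾱ²)⁻¹)` (`RealExpModel.MsFinite.liftPt`) is non-singular exactly when `ᾱ` is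
a non-singular zero of `P̄` for Wilkie's total derivations `∂/∂xⱼ` of `Mˢₙ`: a kernel vector
`(v, w)` of the `2n × 2n` Jacobian has `wᵢ = -2 αᵢ uᵢ² vᵢ` by the last `n` rows, and then the
first `n` rows read `(∂Pᵢ/∂xⱼ)(ᾱ) v = 0` because `∂/∂xⱼ = ∂ˣⱼ + (-2 xⱼ uⱼ²) ∂ᵘⱼ` on `Mˢₙ`
(`RealExpModel.MsFinite.msD_eq`, den Besten's Remark 6.2.6).

* `RealExpModel.MsFinite.DX`, `RealExpModel.MsFinite.DU` — the partial derivations in `xⱼ`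
  (with `∂yⱼ = yⱼ`) and in `uⱼ` (with `∂vⱼ = vⱼ`) of the presentations, and `msD_eq`;
* `RealExpModel.MsFinite.toFn` — a presentation as a term function in `2n` unknowns, its values
  (`evalAt_toFn_liftPt`) and derivatives (`pd_castAdd_toFn`, `pd_natAdd_toFn`);
* `RealExpModel.MsFinite.sysTerms`, `liftPt_mem_nonsingularZeroSet`, `det_jacobian_ne_zero`;
* `RealExpModel.finite_setOf_isMsZero` — **Proposition 9.2 (iii)**.

Nothing here is a named fact; no definition of the earlier files is changed.

## References

* A. J. Wilkie, *Model completeness results for expansions of the ordered field of real numbers by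
  restricted Pfaffian functions and the exponential function*, J. Amer. Math. Soc. 9 (1996),
  1051–1094: Proposition 9.2 (iii), p. 1084. [WilkieJAMS1996]
* M. den Besten, *Wilkie's Theorem and the Uniform Real Schanuel Conjecture*, MSc thesis, Utrecht
  (2016): Definition 6.2.5, Remark 6.2.6, Proposition 6.2.7 (iii); the Claim in the proof of
  Lemma 7.2.4. [DenBesten2016]
* A. J. Wilkie, *On the theory of the real exponential field*, Illinois J. Math. 33 (1989),
  384–408: §5, Proposition (Khovanskiĭ finiteness in the models of `T_exp`). [Wilkie1989]
-/

noncomputable section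

open FirstOrder FirstOrder.Language FirstOrder.Language.Structure
open MvPolynomial

namespace Literature.ModelTheory.ExponentialFields

namespace RealExpModel

variable {k K : Language.Theory.ModelType.{0, 0, 0} realExpTheory}

namespace MsFinite

variable (f : k ↪[Language.orderedExpRing] K) {n : ℕ}

/-! ### The partial derivations `∂ˣⱼ`, `∂ᵘⱼ` of the presentations of `Mˢₙ` -/

/-- Directions of `∂ˣⱼ` (the unknown `xⱼ`, with `yⱼ = exp xⱼ` chained, `uⱼ`, `vⱼ` held fixed):
`∂ˣⱼ xᵢ = δᵢⱼ`, `∂ˣⱼ yᵢ = δᵢⱼ yⱼ`, `∂ˣⱼ uᵢ = ∂ˣⱼ vᵢ = 0`. [folklore] -/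
def dirX (j : Fin n) : MsVar n → MvPolynomial (MsVar n) k
  | (MsKind.x, i) => if i = j then 1 else 0
  | (MsKind.u, _) => 0
  | (MsKind.v, _) => 0
  | (MsKind.y, i) => if i = j then X (MsKind.y, j) else 0

/-- Directions of `∂ᵘⱼ` (the unknown `uⱼ`, with `vⱼ = exp uⱼ` chained, `xⱼ`, `yⱼ` held fixed):
`∂ᵘⱼ uᵢ = δᵢⱼ`, `∂ᵘⱼ vᵢ = δᵢⱼ vⱼ`, `∂ᵘⱼ xᵢ = ∂ᵘⱼ yᵢ = 0`. [folklore] -/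
def dirU (j : Fin n) : MsVar n → MvPolynomial (MsVar n) k
  | (MsKind.x, _) => 0
  | (MsKind.u, i) => if i = j then 1 else 0
  | (MsKind.v, i) => if i = j then X (MsKind.v, j) else 0
  | (MsKind.y, _) => 0

/-- The `k`-derivation `∂ˣⱼ` of the presentations of `Mˢₙ`. [folklore] -/
def DX (k : Language.Theory.ModelType.{0, 0, 0} realExpTheory) (j : Fin n) :
    Derivation k (MvPolynomial (MsVar n) k) (MvPolynomial (MsVar n) k) :=
  mkDerivation k (dirX j)

/-- The `k`-derivation `∂ᵘⱼ` of the presentations of `Mˢₙ`. [folklore] -/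
def DU (k : Language.Theory.ModelType.{0, 0, 0} realExpTheory) (j : Fin n) :
    Derivation k (MvPolynomial (MsVar n) k) (MvPolynomial (MsVar n) k) :=
  mkDerivation k (dirU j)

/-- `∂ˣⱼ` of a generator. [folklore] -/
@[simp] theorem DX_X (j : Fin n) (w : MsVar n) : DX k j (X w) = dirX j w := mkDerivation_X _ _ _

/-- `∂ᵘⱼ` of a generator. [folklore] -/
@[simp] theorem DU_X (j : Fin n) (w : MsVar n) : DU k j (X w) = dirU j w := mkDerivation_X _ _ _

/-- `∂ˣⱼ` of a constant. [folklore] -/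
@[simp] theorem DX_C (j : Fin n) (c : k) : DX k j (C c : MvPolynomial (MsVar n) k) = 0 :=
  derivation_C _ _

/-- `∂ᵘⱼ` of a constant. [folklore] -/
@[simp] theorem DU_C (j : Fin n) (c : k) : DU k j (C c : MvPolynomial (MsVar n) k) = 0 :=
  derivation_C _ _

/-- The chain factor `duⱼ/dxⱼ = -2 xⱼ uⱼ²` (as a presentation). [cite: DenBesten2016, Remark 6.2.6] -/
def uDot (j : Fin n) : MvPolynomial (MsVar n) k :=
  C (-2) * X (MsKind.x, j) * X (MsKind.u, j) ^ 2

/-- On generators, Wilkie's total derivation is `∂/∂xⱼ = ∂ˣⱼ + (duⱼ/dxⱼ) ∂ᵘⱼ`. [cite: DenBesten2016, Remark 6.2.6] -/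
theorem msDir_eq (j : Fin n) (w : MsVar n) :
    (msDir j w : MvPolynomial (MsVar n) k) = dirX j w + uDot j * dirU j w := by
  rcases w with ⟨κ, i⟩
  cases κ <;> by_cases h : i = j <;> simp [msDir, dirX, dirU, uDot, h]

/-- **`∂/∂xⱼ = ∂ˣⱼ + (-2 xⱼ uⱼ²) ∂ᵘⱼ` on `Mˢₙ`** (the chain rule behind den Besten's Remark 6.2.6:
`uⱼ = (1 + xⱼ²)⁻¹`, `vⱼ = exp uⱼ`). [cite: DenBesten2016, Remark 6.2.6] -/
theorem msD_eq (j : Fin n) (Q : MvPolynomial (MsVar n) k) :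
    msD k j Q = DX k j Q + uDot j * DU k j Q := by
  induction Q using MvPolynomial.induction_on with
  | C c => rw [msD_C, DX_C, DU_C, mul_zero, add_zero]
  | add p q hp hq => rw [_root_.map_add, _root_.map_add, _root_.map_add, hp, hq]; ring
  | mul_X p w hp =>
    rw [Derivation.leibniz, Derivation.leibniz, Derivation.leibniz, smul_eq_mul, smul_eq_mul,
      smul_eq_mul, smul_eq_mul, smul_eq_mul, smul_eq_mul, hp, msD_X, DX_X, DU_X, msDir_eq]
    ring

/-! ### Presentations as term functions in the `2n` unknowns `(x̄, ū)` -/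

section TermFunctions

/-- `xᵢ` and `uⱼ` never share an index among the `2n` unknowns. [folklore] -/
theorem castAdd_ne_natAdd (i j : Fin n) : Fin.castAdd n i ≠ Fin.natAdd n j := by
  intro h
  have h' := congrArg Fin.val h
  simp only [Fin.val_castAdd, Fin.val_natAdd] at h'
  have := i.isLt
  omega

/-- `uᵢ` and `xⱼ` never share an index among the `2n` unknowns. [folklore] -/
theorem natAdd_ne_castAdd (i j : Fin n) : Fin.natAdd n i ≠ Fin.castAdd n j :=
  fun h => castAdd_ne_natAdd j i h.symm

/-- The generators of `Mˢₙ` as term functions of the unknowns `(x̄, ū) ∈ K²ⁿ`: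
`xᵢ ↦ xᵢ`, `uᵢ ↦ uᵢ`, `vᵢ ↦ exp uᵢ`, `yᵢ ↦ exp xᵢ`. [folklore] -/
def gen : MsVar n → termFnRing f (n + n)
  | (MsKind.x, i) => coordFn f (n + n) (Fin.castAdd n i)
  | (MsKind.u, i) => coordFn f (n + n) (Fin.natAdd n i)
  | (MsKind.v, i) => expFn f (n + n) (coordFn f (n + n) (Fin.natAdd n i))
  | (MsKind.y, i) => expFn f (n + n) (coordFn f (n + n) (Fin.castAdd n i))

/-- **A presentation of an element of `Mˢₙ` as an exponential term function in the `2n` unknowns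
`(x̄, ū)`** (constants from `k` along `f`). [folklore] -/
def toFn : MvPolynomial (MsVar n) k →+* termFnRing f (n + n) :=
  eval₂Hom (constHom f (n + n)) (gen f)

/-- `toFn` of a generator. [folklore] -/
@[simp] theorem toFn_X (w : MsVar n) : toFn f (X w) = gen f w :=
  eval₂Hom_X' _ _ _

/-- `toFn` of a constant. [folklore] -/
@[simp] theorem toFn_C (c : k) : toFn f (C c) = constFn f (n + n) c :=
  eval₂Hom_C _ _ _

/-- The values of the generators at a point `(x̄, ū) ∈ K²ⁿ`. [folklore] -/
def genVal (x : Fin (n + n) → K) : MsVar n → K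
  | (MsKind.x, i) => x (Fin.castAdd n i)
  | (MsKind.u, i) => x (Fin.natAdd n i)
  | (MsKind.v, i) => exp (x (Fin.natAdd n i))
  | (MsKind.y, i) => exp (x (Fin.castAdd n i))

/-- Values of `gen`. [folklore] -/
theorem coe_gen (w : MsVar n) (x : Fin (n + n) → K) :
    ((gen f w : termFnRing f (n + n)) : (Fin (n + n) → K) → K) x = genVal x w := by
  rcases w with ⟨κ, i⟩
  cases κ <;> rfl

/-- Values of `toFn P`: the evaluation of the presentation at the values of the generators.
[folklore] -/
theorem evalAt_toFn (x : Fin (n + n) → K) (Q : MvPolynomial (MsVar n) k) :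
    evalAt f (n + n) x (toFn f Q) = eval₂Hom (toRingHom f) (genVal x) Q := by
  rw [toFn, ← RingHom.comp_apply, MvPolynomial.comp_eval₂Hom]
  have h1 : (evalAt f (n + n) x).comp (constHom f (n + n)) = toRingHom f := by
    ext c; simp
  have h2 : (fun w => evalAt f (n + n) x (gen f w)) = genVal x := by
    funext w; rw [evalAt_apply, coe_gen]
  rw [h1, h2]

/-- The lift `ᾱ ↦ (ᾱ, (1 + ᾱ²)⁻¹)` of a point of `Kⁿ` to the `2n` unknowns `(x̄, ū)`. [folklore] -/
def liftPt (α : Fin n → K) : Fin (n + n) → K :=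
  Fin.append α fun i => (1 + α i ^ 2)⁻¹

/-- The `x̄`-coordinates of the lift. [folklore] -/
@[simp] theorem liftPt_castAdd (α : Fin n → K) (i : Fin n) : liftPt α (Fin.castAdd n i) = α i :=
  Fin.append_left _ _ _

/-- The `ū`-coordinates of the lift. [folklore] -/
@[simp] theorem liftPt_natAdd (α : Fin n → K) (i : Fin n) :
    liftPt α (Fin.natAdd n i) = (1 + α i ^ 2)⁻¹ :=
  Fin.append_right _ _ _

/-- The lift is injective. [folklore] -/
theorem liftPt_injective : Function.Injective (liftPt (K := K) (n := n)) := by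
  intro α β h
  funext i
  have := congrFun h (Fin.castAdd n i)
  simpa using this

/-- At the lift the generators take Wilkie's values `RealExpModel.msVal`. [folklore] -/
theorem genVal_liftPt (α : Fin n → K) : genVal (liftPt α) = msVal α := by
  funext w
  rcases w with ⟨κ, i⟩
  cases κ <;> simp only [genVal, msVal, liftPt_castAdd, liftPt_natAdd]

/-- At the lift, `toFn P` takes the value `P(ᾱ)` (`RealExpModel.msEval`). [folklore] -/
theorem evalAt_toFn_liftPt (α : Fin n → K) (Q : MvPolynomial (MsVar n) k) :
    evalAt f (n + n) (liftPt α) (toFn f Q) = msEval f α Q := by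
  rw [evalAt_toFn, genVal_liftPt]
  rfl

/-- `∂/∂xⱼ` of the generators (as term functions) is `∂ˣⱼ`. [folklore] -/
theorem pd_castAdd_gen (j : Fin n) (w : MsVar n) :
    pd f (n + n) (Fin.castAdd n j) (gen f w) = toFn f (dirX j w) := by
  rcases w with ⟨κ, i⟩
  cases κ with
  | x =>
    change pd f (n + n) (Fin.castAdd n j) (coordFn f (n + n) (Fin.castAdd n i)) =
      toFn f (if i = j then 1 else 0)
    by_cases h : i = j
    · subst h
      rw [pd_coordFn, if_pos rfl, if_pos rfl, _root_.map_one]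
    · rw [pd_coordFn, if_neg (fun e => h (Fin.castAdd_injective _ _ e)), if_neg h, _root_.map_zero]
  | u =>
    change pd f (n + n) (Fin.castAdd n j) (coordFn f (n + n) (Fin.natAdd n i)) = toFn f 0
    rw [pd_coordFn, if_neg (natAdd_ne_castAdd i j), _root_.map_zero]
  | v =>
    change pd f (n + n) (Fin.castAdd n j) (expFn f (n + n) (coordFn f (n + n) (Fin.natAdd n i))) =
      toFn f 0
    rw [pd_expFn, pd_coordFn, if_neg (natAdd_ne_castAdd i j), mul_zero, _root_.map_zero]
  | y =>
    change pd f (n + n) (Fin.castAdd n j) (expFn f (n + n) (coordFn f (n + n) (Fin.castAdd n i))) =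
      toFn f (if i = j then X (MsKind.y, j) else 0)
    by_cases h : i = j
    · subst h
      rw [pd_expFn, pd_coordFn, if_pos rfl, mul_one, if_pos rfl, toFn_X]
      rfl
    · rw [pd_expFn, pd_coordFn, if_neg (fun e => h (Fin.castAdd_injective _ _ e)), mul_zero,
        if_neg h, _root_.map_zero]

/-- `∂/∂uⱼ` of the generators (as term functions) is `∂ᵘⱼ`. [folklore] -/
theorem pd_natAdd_gen (j : Fin n) (w : MsVar n) :
    pd f (n + n) (Fin.natAdd n j) (gen f w) = toFn f (dirU j w) := by
  rcases w with ⟨κ, i⟩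
  cases κ with
  | x =>
    change pd f (n + n) (Fin.natAdd n j) (coordFn f (n + n) (Fin.castAdd n i)) = toFn f 0
    rw [pd_coordFn, if_neg (castAdd_ne_natAdd i j), _root_.map_zero]
  | u =>
    change pd f (n + n) (Fin.natAdd n j) (coordFn f (n + n) (Fin.natAdd n i)) =
      toFn f (if i = j then 1 else 0)
    by_cases h : i = j
    · subst h
      rw [pd_coordFn, if_pos rfl, if_pos rfl, _root_.map_one]
    · rw [pd_coordFn, if_neg (fun e => h (Fin.natAdd_injective _ _ e)), if_neg h, _root_.map_zero]
  | v =>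
    change pd f (n + n) (Fin.natAdd n j) (expFn f (n + n) (coordFn f (n + n) (Fin.natAdd n i))) =
      toFn f (if i = j then X (MsKind.v, j) else 0)
    by_cases h : i = j
    · subst h
      rw [pd_expFn, pd_coordFn, if_pos rfl, mul_one, if_pos rfl, toFn_X]
      rfl
    · rw [pd_expFn, pd_coordFn, if_neg (fun e => h (Fin.natAdd_injective _ _ e)), mul_zero,
        if_neg h, _root_.map_zero]
  | y =>
    change pd f (n + n) (Fin.natAdd n j) (expFn f (n + n) (coordFn f (n + n) (Fin.castAdd n i))) =
      toFn f 0
    rw [pd_expFn, pd_coordFn, if_neg (castAdd_ne_natAdd i j), mul_zero, _root_.map_zero]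

/-- **`∂(toFn P)/∂xⱼ = toFn (∂ˣⱼ P)`.** [folklore] -/
theorem pd_castAdd_toFn (j : Fin n) (Q : MvPolynomial (MsVar n) k) :
    pd f (n + n) (Fin.castAdd n j) (toFn f Q) = toFn f (DX k j Q) := by
  induction Q using MvPolynomial.induction_on with
  | C c => rw [toFn_C, DX_C, _root_.map_zero]; exact pd_constFn f (n + n) _ c
  | add p q hp hq => simp only [_root_.map_add, pd_add, hp, hq]
  | mul_X p w hp =>
    rw [_root_.map_mul, pd_mul, hp, toFn_X, pd_castAdd_gen, Derivation.leibniz, smul_eq_mul,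
      smul_eq_mul, _root_.map_add, _root_.map_mul, _root_.map_mul, toFn_X, DX_X,
      add_comm (toFn f (DX k j p) * gen f w), mul_comm (toFn f (DX k j p)) (gen f w)]

/-- **`∂(toFn P)/∂uⱼ = toFn (∂ᵘⱼ P)`.** [folklore] -/
theorem pd_natAdd_toFn (j : Fin n) (Q : MvPolynomial (MsVar n) k) :
    pd f (n + n) (Fin.natAdd n j) (toFn f Q) = toFn f (DU k j Q) := by
  induction Q using MvPolynomial.induction_on with
  | C c => rw [toFn_C, DU_C, _root_.map_zero]; exact pd_constFn f (n + n) _ c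
  | add p q hp hq => simp only [_root_.map_add, pd_add, hp, hq]
  | mul_X p w hp =>
    rw [_root_.map_mul, pd_mul, hp, toFn_X, pd_natAdd_gen, Derivation.leibniz, smul_eq_mul,
      smul_eq_mul, _root_.map_add, _root_.map_mul, _root_.map_mul, toFn_X, DU_X,
      add_comm (toFn f (DU k j p) * gen f w), mul_comm (toFn f (DU k j p)) (gen f w)]

/-! ### The square system of `2n` terms and its Jacobian at the lift -/

/-- The constraint `uᵢ (1 + xᵢ²) - 1` tying `uᵢ` to `(1 + xᵢ²)⁻¹`. [folklore] -/
def conFn (i : Fin n) : termFnRing f (n + n) :=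
  coordFn f (n + n) (Fin.natAdd n i) * (1 + coordFn f (n + n) (Fin.castAdd n i) ^ 2) - 1

/-- The `2n` term functions: the presented system, then the `n` constraints. [folklore] -/
def sysFn (P : Fin n → MvPolynomial (MsVar n) k) : Fin (n + n) → termFnRing f (n + n) :=
  Fin.append (fun i => toFn f (P i)) (conFn f)

/-- **The square system of `2n` exponential terms with parameters from `k` presenting a system
`P₁, …, Pₙ` from `Mˢₙ`.** [folklore] -/
def sysTerms (P : Fin n → MvPolynomial (MsVar n) k) :
    Fin (n + n) → Language.orderedExpRing.Term (k ⊕ Fin (n + n)) :=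
  fun r => reprTerm f (n + n) (sysFn f P r)

/-- `fnOf (reprTerm F) = F`. [folklore] -/
theorem fnOf_reprTerm (F : termFnRing f (n + n)) : fnOf f (n + n) (reprTerm f (n + n) F) = F :=
  Subtype.ext (termFn_reprTerm f (n + n) F)

/-- The terms realize to the term functions. [folklore] -/
theorem realize_sysTerms (P : Fin n → MvPolynomial (MsVar n) k) (r : Fin (n + n))
    (x : Fin (n + n) → K) :
    (sysTerms f P r).realize (Sum.elim (f : k → K) x) = evalAt f (n + n) x (sysFn f P r) := by
  rw [sysTerms, realize_reprTerm, evalAt_apply]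

/-- Their formal partial derivatives realize to the derivations `∂/∂xₗ` of the term functions.
[folklore] -/
theorem realize_termPDeriv_sysTerms (P : Fin n → MvPolynomial (MsVar n) k) (r l : Fin (n + n))
    (x : Fin (n + n) → K) :
    (termPDeriv l (sysTerms f P r)).realize (Sum.elim (f : k → K) x) =
      evalAt f (n + n) x (pd f (n + n) l (sysFn f P r)) := by
  rw [evalAt_apply, coe_pd_of_eq f (n + n) l (fnOf_reprTerm f (sysFn f P r)) x]
  rfl

variable {f}
variable {s : Finset (Fin n)} {P : Fin n → MvPolynomial (MsVar n) k} {α : Fin n → K}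

/-- **The lift of a zero of `P̄` is a zero of the `2n`-system.** [folklore] -/
theorem liftPt_mem_zeroSet (h : IsMsZero f s P α) :
    liftPt α ∈ zeroSet (sysTerms f P) (f : k → K) := by
  rw [mem_zeroSet]
  intro r
  rw [realize_sysTerms]
  induction r using Fin.addCases with
  | left i =>
    rw [sysFn, Fin.append_left, evalAt_toFn_liftPt]
    exact h.2.1 i
  | right i =>
    have hpos : (1 + α i ^ 2 : K) ≠ 0 := by positivity
    rw [sysFn, Fin.append_right, conFn, _root_.map_sub, _root_.map_mul, _root_.map_add,
      _root_.map_one, _root_.map_pow, evalAt_apply, evalAt_apply, coe_coordFn, coe_coordFn,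
      liftPt_natAdd, liftPt_castAdd, inv_mul_cancel₀ hpos, sub_self]

variable (f P α) in
/-- The Jacobian of the `2n`-system at the lift. [folklore] -/
abbrev jac : Matrix (Fin (n + n)) (Fin (n + n)) K := jacobian (sysTerms f P) (f : k → K) (liftPt α)

/-- Entries of the Jacobian through the derivations of term functions. [folklore] -/
theorem jac_apply (r l : Fin (n + n)) :
    jac f P α r l = evalAt f (n + n) (liftPt α) (pd f (n + n) l (sysFn f P r)) := by
  rw [jac, jacobian_apply, realize_termPDeriv_sysTerms]

/-- Block `(x̄, x̄)`: `∂ˣⱼ Pᵢ (ᾱ)`. [folklore] -/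
theorem jac_castAdd_castAdd (i j : Fin n) :
    jac f P α (Fin.castAdd n i) (Fin.castAdd n j) = msEval f α (DX k j (P i)) := by
  rw [jac_apply, sysFn, Fin.append_left, pd_castAdd_toFn, evalAt_toFn_liftPt]

/-- Block `(x̄, ū)`: `∂ᵘⱼ Pᵢ (ᾱ)`. [folklore] -/
theorem jac_castAdd_natAdd (i j : Fin n) :
    jac f P α (Fin.castAdd n i) (Fin.natAdd n j) = msEval f α (DU k j (P i)) := by
  rw [jac_apply, sysFn, Fin.append_left, pd_natAdd_toFn, evalAt_toFn_liftPt]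

/-- Block `(ū, x̄)`: `∂(uᵢ(1 + xᵢ²) - 1)/∂xⱼ = δᵢⱼ · 2 αᵢ uᵢ` at the lift. [folklore] -/
theorem jac_natAdd_castAdd (i j : Fin n) :
    jac f P α (Fin.natAdd n i) (Fin.castAdd n j) =
      if i = j then 2 * α i * (1 + α i ^ 2)⁻¹ else 0 := by
  rw [jac_apply, sysFn, Fin.append_right, conFn]
  simp only [pd_sub, pd_mul, pd_add, pd_one, pow_two, pd_coordFn, natAdd_ne_castAdd, if_false,
    Fin.castAdd_inj, zero_mul, zero_add, sub_zero, _root_.map_mul, _root_.map_add, evalAt_apply,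
    coe_coordFn, liftPt_natAdd, liftPt_castAdd]
  by_cases h : i = j
  · subst h; simp; ring
  · simp [h]

/-- Block `(ū, ū)`: `∂(uᵢ(1 + xᵢ²) - 1)/∂uⱼ = δᵢⱼ (1 + αᵢ²)` at the lift. [folklore] -/
theorem jac_natAdd_natAdd (i j : Fin n) :
    jac f P α (Fin.natAdd n i) (Fin.natAdd n j) = if i = j then 1 + α i ^ 2 else 0 := by
  rw [jac_apply, sysFn, Fin.append_right, conFn]
  simp only [pd_sub, pd_mul, pd_add, pd_one, pow_two, pd_coordFn, castAdd_ne_natAdd, if_false,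
    Fin.natAdd_inj, zero_mul, mul_zero, add_zero, sub_zero, _root_.map_mul, _root_.map_add,
    _root_.map_one, evalAt_apply, coe_coordFn, liftPt_castAdd]
  by_cases h : i = j
  · subst h; simp
  · simp [h]

/-- Value of the chain factor at `ᾱ`: `-2 αⱼ ((1 + αⱼ²)⁻¹)²`. [folklore] -/
theorem msEval_uDot (j : Fin n) :
    msEval f α (uDot j : MvPolynomial (MsVar n) k) = -2 * α j * ((1 + α j ^ 2)⁻¹) ^ 2 := by
  rw [uDot, _root_.map_mul, _root_.map_mul, _root_.map_pow, msEval_X, msEval_X, msVal_x, msVal_u, msEval_C]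
  have : (f (-2 : k) : K) = -2 := by
    rw [RealExpModel.map_neg, MsStep.map_ofNat']
  rw [this]

/-- **The `2n`-system is non-singular at the lift of a non-singular zero of `P̄`** (kernel
argument: `wᵢ = -2 αᵢ uᵢ² vᵢ` from the constraint rows, then `(∂Pᵢ/∂xⱼ(ᾱ)) v = 0` by
`msD_eq`). [cite: DenBesten2016, Remark 6.2.6] -/
theorem det_jac_ne_zero (h : IsMsZero f s P α) : (jac f P α).det ≠ 0 := by
  classical
  intro hdet
  obtain ⟨ξ, hξ0, hξ⟩ := Matrix.exists_mulVec_eq_zero_iff.2 hdet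
  have row : ∀ r, ∑ j : Fin n, jac f P α r (Fin.castAdd n j) * ξ (Fin.castAdd n j) +
      ∑ j : Fin n, jac f P α r (Fin.natAdd n j) * ξ (Fin.natAdd n j) = 0 := by
    intro r
    have := congrFun hξ r
    rw [Matrix.mulVec, dotProduct, Fin.sum_univ_add] at this
    exact this
  -- the constraint rows: `w i = -2 αᵢ uᵢ² vᵢ`
  have hw : ∀ i, ξ (Fin.natAdd n i) =
      -2 * α i * ((1 + α i ^ 2)⁻¹) ^ 2 * ξ (Fin.castAdd n i) := by
    intro i
    have R := row (Fin.natAdd n i)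
    simp only [jac_natAdd_castAdd, jac_natAdd_natAdd, ite_mul, zero_mul, Finset.sum_ite_eq,
      Finset.mem_univ, if_true] at R
    have hpos : (1 + α i ^ 2 : K) ≠ 0 := by positivity
    have hu : (1 + α i ^ 2 : K) * (1 + α i ^ 2)⁻¹ = 1 := mul_inv_cancel₀ hpos
    have e : ξ (Fin.natAdd n i) = (1 + α i ^ 2)⁻¹ * ((1 + α i ^ 2) * ξ (Fin.natAdd n i)) := by
      rw [← mul_assoc, inv_mul_cancel₀ hpos, one_mul]
    rw [e]
    linear_combination (1 + α i ^ 2)⁻¹ * R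
  -- the first `n` rows: `J(P̄)(ᾱ) v = 0`
  have hv : ∀ i, ∑ j : Fin n, msEval f α (msD k j (P i)) * ξ (Fin.castAdd n j) = 0 := by
    intro i
    have R := row (Fin.castAdd n i)
    simp only [jac_castAdd_castAdd, jac_castAdd_natAdd] at R
    rw [← Finset.sum_add_distrib] at R
    rw [← R]
    refine Finset.sum_congr rfl fun j _ => ?_
    rw [msD_eq, _root_.map_add, _root_.map_mul, msEval_uDot, hw j]
    ring
  have hv0 : (fun j => ξ (Fin.castAdd n j)) = 0 := by
    by_contra hne
    refine h.2.2 (Matrix.exists_mulVec_eq_zero_iff.1 ⟨_, hne, ?_⟩)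
    funext i
    rw [Matrix.mulVec, dotProduct]
    simpa using hv i
  have hvj : ∀ j, ξ (Fin.castAdd n j) = 0 := fun j => congrFun hv0 j
  apply hξ0
  funext r
  induction r using Fin.addCases with
  | left i => exact hvj i
  | right i => rw [Pi.zero_apply, hw i, hvj i, mul_zero]

/-- **The lift of a non-singular zero of a system from `Mˢₙ` is a non-singular zero of the
`2n`-system of terms.** [folklore] -/
theorem liftPt_mem_nonsingularZeroSet (h : IsMsZero f s P α) :
    liftPt α ∈ nonsingularZeroSet (sysTerms f P) (f : k → K) := by
  refine ⟨liftPt_mem_zeroSet h, ?_⟩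
  have hu : IsUnit (jac f P α) := by
    rw [Matrix.isUnit_iff_isUnit_det, isUnit_iff_ne_zero]
    exact det_jac_ne_zero h
  exact Matrix.linearIndependent_rows_iff_isUnit.2 hu

end TermFunctions

end MsFinite

open MsFinite in
/-- **Wilkie 1996, Proposition 9.2 (iii) (den Besten 2016, Proposition 6.2.7 (iii)).** Let
`k ⊆ K` be models of `T_exp` (embedding `f`), `n ∈ ℕ`, `s ⊆ {1, …, n}` and `P₁, …, Pₙ ∈ Mˢₙ`.
Then there are only finitely many `γ̄ ∈ Kⁿ` with `P₁(γ̄) = ⋯ = Pₙ(γ̄) = 0` and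
`det (∂(P₁, …, Pₙ)/∂(x₁, …, xₙ))(γ̄) ≠ 0` — by Khovanskiĭ's finiteness theorem transferred to the
models of `T_exp` (Wilkie 1989, §5), applied to the presenting `2n`-system of exponential terms.
[cite: WilkieJAMS1996, Proposition 9.2 (iii), p. 1084] [cite: DenBesten2016, Proposition 6.2.7 (iii)] -/
theorem finite_setOf_isMsZero (f : k ↪[Language.orderedExpRing] K) {n : ℕ} (s : Finset (Fin n))
    (P : Fin n → MvPolynomial (MsVar n) k) : {α : Fin n → K | IsMsZero f s P α}.Finite := by
  have hfin := Wilkie1989_khovanskiiProposition_holds.finite_nonsingularZeroSet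
    (sysTerms f P) K (f : k → K)
  refine (hfin.preimage liftPt_injective.injOn).subset ?_
  intro α hα
  exact liftPt_mem_nonsingularZeroSet hα

open MsFinite in
/-- In particular a system from `Mˢₙ` has a finite `Finset` of non-singular zeros in `Kⁿ`, and
every non-singular zero belongs to it. [cite: WilkieJAMS1996, Proposition 9.2 (iii), p. 1084] -/
theorem exists_finset_isMsZero (f : k ↪[Language.orderedExpRing] K) {n : ℕ} (s : Finset (Fin n))
    (P : Fin n → MvPolynomial (MsVar n) k) :
    ∃ Z : Finset (Fin n → K), ∀ α, α ∈ Z ↔ IsMsZero f s P α := by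
  refine ⟨(finite_setOf_isMsZero f s P).toFinset, fun α => ?_⟩
  rw [Set.Finite.mem_toFinset, Set.mem_setOf_eq]

end RealExpModel

end Literature.ModelTheory.ExponentialFields
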